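import Literature.NumberTheory.Sieve.PolymathGEHCellAverages
import Literature.NumberTheory.Sieve.PolymathGEHTensorDHLRows
import Literature.NumberTheory.Sieve.PolymathGEHCutoff
import Literature.NumberTheory.Sieve.PolymathThetaSumsProofs
import HarnessLib

/-!
# Theorem 3.14 (going beyond the epsilon enlargement): the analytic step and the `DHL` deduction

Trunk AntSieve, tooling toward the named fact `Literature.NumberTheory.Sieve.weakDHL_three_two_of_GEH`
(D. H. J. Polymath, Res. Math. Sci. 1:12 (2014) = arXiv:1407.4897, Theorem 3.2(xii)).

§5.4 (p. 23): from a test function `F` supported on `(k/(k-1))·R_k` with vanishing `t_i`-marginals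
beyond `Σ_{j≠i} t_j > 1 + ε` and `Σ_i J_{i,1-ε}(F)/I(F) > 2m/ϑ`, the printed proof rescales,
translates, regularises, integrates (`f₃`) and approximates by tensor products (Stone–Weierstrass),
keeping the two support properties (sfk-sum), (sfk-sum-2).  As in the tree's quantitative version of
§5.3 (`PolymathSieveAsymptoticsProofs.lean`) we do all of this at once with the partition of unity
`pouCutoff`, but with coefficients the CELL AVERAGES of `F` (`PolymathGEHCellAverages.lean`), so that
the vanishing marginals are inherited exactly by the row aggregates
(`sum_cellAvg_row_eq_zero`); the `DHL` deduction is then `weakDHL_of_tensorWeights_geh_rows`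
(`PolymathGEHTensorDHLRows.lean`), with Theorem 3.6(ii) (the `GEH` non-prime asymptotic) as an
explicit hypothesis `h36` and `EH[ϑ]` as `PrimesHaveLevel ϑ` (Proposition 2.7).

* `beta_ge'` — the tree's lower bound for `β_i` with the support parameter of the test function
  decoupled from the radius of the `J`-region;
* `weakDHL_of_vanishingMarginals` — **Theorem 3.14 from Theorems 3.5(i), 3.6(ii)** for `k ≥ 3`
  (the case used for Theorem 3.2(xii); `k = 2` would only require enlarging a harmless cutoff);
* `weakDHL_three_two_of_primesLevel_of_nonprimeAsymptotic` — with the cutoff of Theorem 3.15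
  (`GEHCutoff.exists_vanishingMarginalCutoff_three`): `DHL[3,2]` from `EH[θ]` for all `θ < 1` and the
  Theorem 3.6(ii) asymptotic for all `ϑ < 1`.

## References

* [Polymath8b2014] D. H. J. Polymath, Res. Math. Sci. 1 (2014), Art. 12 = arXiv:1407.4897,
  Theorem 3.14, §5.4 (p. 23); §5.3 (pp. 21–23); Theorem 3.15.
-/

noncomputable section

open MeasureTheory Filter Finset Asymptotics Real
open scoped BigOperators Topology

namespace Literature.NumberTheory.Sieve

/-! ### The lower bound for `β_i`, support parameter decoupled -/

section Beta

variable {n : ℕ}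

/-- **(B')** The tree's `beta_ge` with the support parameter `ε'` of the test function (`F`
supported on `(1+ε')·R_k`, `1 + ε' ≤ 2`) decoupled from the radius `1 - ε` of the `J`-region and the
threshold `(1-ε)θ/2` of `𝒥₁`; the proof is verbatim. [cite: Polymath8b2014, Theorem 3.14 (proof, §5.4, p. 23)] -/
theorem beta_ge' {ε ε' θ ρ δ : ℝ} (hε0 : 0 < ε) (hρ : 0 < ρ) (hδ : 0 < δ)
    (h2R : 2 ≤ 1 / ρ) {L : ℕ} (hL : 1 / (ρ * δ) ≤ L) {S₀ : ℝ} (hS₀ : S₀ ≤ 2) (hn : 1 ≤ n)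
    (hΛ : 1 - ε ≤ (1 - ε) * θ / (2 * ρ) - 2 * n * δ)
    (c : (Fin (n + 1) → ℤ) → ℝ) {B : ℝ} (hB0 : 0 ≤ B)
    (hB : ∀ l ∈ goodIndex (n + 1) L δ S₀, |c l| ≤ B)
    {F : (Fin (n + 1) → ℝ) → ℝ} (hF : IsPolymathTestFunction (n + 1) ε' F) (hF1 : Integrable F)
    (hε2 : 1 + ε' ≤ 2) {τ : ℝ} (hτ : 0 < τ) (i : Fin (n + 1)) :
    ρ ^ (n + 1 + 1) * ((polymathJ (n + 1) (1 - ε) i F -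
        (1 + 1 / τ) * (2 * (2 * ∫ x in ioBox (n + 1) (1 / ρ),
          (tensorSum δ (goodIndex (n + 1) L δ S₀) c x - F x) ^ 2))) / (1 + τ) -
        2 * (2 * B) * (2 * B) * (2 * n * δ * (1 / ρ) ^ n)) ≤
      tensorBeta (goodIndex (n + 1) L δ S₀) c (fun i l => pouCutoff ρ δ l i)
        (fun i₁ => (goodIndex (n + 1) L δ S₀).filter fun l =>
          ∑ j ∈ univ.erase i₁, ρ * δ * ((l j : ℝ) + 1) < (1 - ε) * θ / 2) i := by
  classical
  -- names
  set R := 1 / ρ with hRdef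
  set J := goodIndex (n + 1) L δ S₀ with hJ
  set J₁ : Fin (n + 1) → Finset (Fin (n + 1) → ℤ) := fun i₁ => J.filter fun l =>
    ∑ j ∈ univ.erase i₁, ρ * δ * ((l j : ℝ) + 1) < (1 - ε) * θ / 2 with hJ₁
  set J₂ := J.filter fun l => l ∉ J₁ i with hJ₂
  set Λ := (1 - ε) * θ / (2 * ρ) with hΛdef
  set G := tensorSum δ J c with hG
  set Δ := ∫ x in ioBox (n + 1) R, (G x - F x) ^ 2 with hΔdef
  set Ψ₁ := marginalSum δ R i (J₁ i) c with hΨ₁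
  set Ψ₂ := marginalSum δ R i J₂ c with hΨ₂
  set ΨJ := marginalSum δ R i J c with hΨJ
  have hρ1 : ρ ≤ 1 := by
    have : (1 : ℝ) ≤ 1 / ρ := by linarith
    rwa [le_div_iff₀ hρ, one_mul] at this
  have hR1 : (1 : ℝ) ≤ R := by simp only [hRdef]; linarith
  have hR0 : (0 : ℝ) ≤ R := by linarith
  have hk2 : 2 ≤ (n + 1) := by omega
  have hJsub : J ⊆ indexBox (n + 1) L := goodIndex_subset L δ S₀
  have hterm : ∀ l ∈ J, ∀ j, δ * ((l j : ℝ) + 1) ≤ S₀ := fun l hl j =>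
    term_le_of_mem_goodIndex hδ.le hl j
  -- Step 1: `β = ρ^{(n + 1)+1} ∫_{betaBox} (Ψ₁ + 2Ψ₂) Ψ₁`
  have hβ := tensorBeta_pouCutoff hρ hρ1 hδ J c J₁ i (Finset.filter_subset _ _) (by omega)
    (fun l hl => (hterm l hl i).trans (hS₀.trans h2R))
  rw [hβ]
  refine mul_le_mul_of_nonneg_left ?_ (pow_nonneg hρ.le _)
  -- Step 2: pointwise lower bound on `betaBox`
  have hS₁ : ∀ l ∈ J₁ i, ∑ j ∈ univ.erase i, δ * ((l j : ℝ) + 1) ≤ Λ := by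
    intro l hl
    have h := (Finset.mem_filter.1 hl).2
    have hfac : ∑ j ∈ univ.erase i, ρ * δ * ((l j : ℝ) + 1) =
        ρ * ∑ j ∈ univ.erase i, δ * ((l j : ℝ) + 1) := by
      rw [Finset.mul_sum]; refine Finset.sum_congr rfl fun j _ => by ring
    rw [hfac] at h
    rw [hΛdef, le_div_iff₀ (by positivity)]
    linarith
  have hS₂ : ∀ l ∈ J₂, Λ ≤ ∑ j ∈ univ.erase i, δ * ((l j : ℝ) + 1) := by
    intro l hl
    have hlJ : l ∈ J := (Finset.mem_filter.1 hl).1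
    have h := (Finset.mem_filter.1 hl).2
    rw [hJ₁, Finset.mem_filter, not_and] at h
    have h' := h hlJ
    push Not at h'
    have hfac : ∑ j ∈ univ.erase i, ρ * δ * ((l j : ℝ) + 1) =
        ρ * ∑ j ∈ univ.erase i, δ * ((l j : ℝ) + 1) := by
      rw [Finset.mul_sum]; refine Finset.sum_congr rfl fun j _ => by ring
    rw [hfac] at h'
    rw [hΛdef, div_le_iff₀ (by positivity)]
    linarith
  have hbound : ∀ S, S ⊆ J → ∀ x ∈ betaBox (n + 1) R i, |marginalSum δ R i S c x| ≤ 2 * B := by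
    intro S hS x hx
    refine abs_marginalSum_le hδ hρ h2R hL hS hJsub i (fun l hl => (hterm l hl i).trans hS₀) hB0 hB
      fun j hj => ?_
    rw [betaBox, Set.mem_univ_pi] at hx
    have := hx j
    rw [if_neg hj] at this
    exact this
  have hsum12 : ∀ x, Ψ₁ x + Ψ₂ x = ΨJ x := fun x => by
    simp only [hΨ₁, hΨ₂, hΨJ, marginalSum, hJ₂]
    rw [← Finset.sum_filter_add_sum_filter_not J (· ∈ J₁ i)]
    congr 1
    rw [Finset.filter_mem_eq_inter, Finset.inter_eq_right.2 (Finset.filter_subset _ _)]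
  set A : Set (Fin (n + 1) → ℝ) := {x | ∑ j ∈ univ.erase i, x j ≤ Λ - 2 * (((n + 1 : ℕ) : ℝ) - 1) * δ} with hA
  set Sh : Set (Fin (n + 1) → ℝ) := {x | Λ - 2 * (((n + 1 : ℕ) : ℝ) - 1) * δ < ∑ j ∈ univ.erase i, x j ∧
    ∑ j ∈ univ.erase i, x j < Λ} with hSh
  have hmsum : Measurable fun x : Fin (n + 1) → ℝ => ∑ j ∈ univ.erase i, x j :=
    Finset.measurable_sum _ fun j _ => measurable_pi_apply j
  have hAm : MeasurableSet A := measurableSet_le hmsum measurable_const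
  have hShm : MeasurableSet Sh :=
    (measurableSet_lt measurable_const hmsum).inter (measurableSet_lt hmsum measurable_const)
  have hpt : ∀ x ∈ betaBox (n + 1) R i,
      A.indicator (fun x => ΨJ x ^ 2) x - Sh.indicator (fun _ => 2 * (2 * B) * (2 * B)) x ≤
        (Ψ₁ x + 2 * Ψ₂ x) * Ψ₁ x := by
    intro x hx
    have h := beta_integrand_lower_bound (R := R) (c := c) hδ hS₁ hS₂ hk2
      (hbound _ (Finset.filter_subset _ _) x hx) (hbound _ (Finset.filter_subset _ _) x hx)
    simp only [Set.indicator_apply, hA, hSh, Set.mem_setOf_eq, ← hsum12 x]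
    convert h using 2
  -- Step 3: integrate over `betaBox`
  have hcont1 : Continuous fun x => (Ψ₁ x + 2 * Ψ₂ x) * Ψ₁ x := by
    simp only [hΨ₁, hΨ₂]
    exact ((marginalSum_continuous _ _ _ _ _).add
      (continuous_const.mul (marginalSum_continuous _ _ _ _ _))).mul (marginalSum_continuous _ _ _ _ _)
  have hcontJ : Continuous fun x => ΨJ x ^ 2 := (marginalSum_continuous _ _ _ _ _).pow 2
  have hvolβ : volume (betaBox (n + 1) R i) < ⊤ :=
    lt_of_le_of_lt (measure_mono (betaBox_subset_Icc hR1 i)) measure_Icc_lt_top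
  have hiA : IntegrableOn (A.indicator fun x => ΨJ x ^ 2) (betaBox (n + 1) R i) :=
    (integrableOn_betaBox_of_continuous hcontJ hR1 i).indicator hAm
  have hiSh : IntegrableOn (Sh.indicator fun _ => 2 * (2 * B) * (2 * B)) (betaBox (n + 1) R i) :=
    (integrableOn_const hvolβ.ne).indicator hShm
  have hint_lower : ∫ x in betaBox (n + 1) R i, (A.indicator (fun x => ΨJ x ^ 2) x -
      Sh.indicator (fun _ => 2 * (2 * B) * (2 * B)) x) ≤
      ∫ x in betaBox (n + 1) R i, (Ψ₁ x + 2 * Ψ₂ x) * Ψ₁ x :=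
    setIntegral_mono_on (hiA.sub hiSh) (integrableOn_betaBox_of_continuous hcont1 hR1 i)
      (measurableSet_betaBox R i) hpt
  have hsplit : ∫ x in betaBox (n + 1) R i, (A.indicator (fun x => ΨJ x ^ 2) x -
      Sh.indicator (fun _ => 2 * (2 * B) * (2 * B)) x) =
      (∫ x in betaBox (n + 1) R i ∩ A, ΨJ x ^ 2) -
        2 * (2 * B) * (2 * B) * (volume (betaBox (n + 1) R i ∩ Sh)).toReal := by
    rw [integral_sub hiA hiSh, setIntegral_indicator hAm, setIntegral_indicator hShm,
      setIntegral_const, smul_eq_mul, measureReal_def, mul_comm]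
  -- Step 4: the shell volume
  obtain ⟨j, hj⟩ := exists_ne_fin hn i
  have hw : (2 : ℝ) * (((n + 1 : ℕ) : ℝ) - 1) * δ = 2 * n * δ := by push_cast; ring
  have hshell : (volume (betaBox (n + 1) R i ∩ Sh)).toReal ≤ 2 * n * δ * R ^ n := by
    have hv := volume_shell_le hR1 i j hj Λ (2 * (((n + 1 : ℕ) : ℝ) - 1) * δ)
    have hv' : volume (betaBox (n + 1) R i ∩ Sh) ≤
        ENNReal.ofReal (2 * (((n + 1 : ℕ) : ℝ) - 1) * δ) * ENNReal.ofReal R ^ n := by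
      rw [Set.inter_comm]; simpa only [hSh] using hv
    have hfin : ENNReal.ofReal (2 * (((n + 1 : ℕ) : ℝ) - 1) * δ) * ENNReal.ofReal R ^ n ≠ ⊤ :=
      ENNReal.mul_ne_top ENNReal.ofReal_ne_top (ENNReal.pow_ne_top ENNReal.ofReal_ne_top)
    have := ENNReal.toReal_mono hfin hv'
    rw [ENNReal.toReal_mul, ENNReal.toReal_pow, ENNReal.toReal_ofReal (by rw [hw]; positivity),
      ENNReal.toReal_ofReal hR0, hw] at this
    exact this
  -- Step 5: `∫_{betaBox ∩ A} ΨJ² ≥ ∫_Q ΨJ²`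
  set Q := betaBox (n + 1) R i ∩ {x | ∑ j ∈ univ.erase i, x j ≤ 1 - ε} with hQ
  have hQm : MeasurableSet Q :=
    (measurableSet_betaBox R i).inter (measurableSet_le hmsum measurable_const)
  have hQsub : Q ⊆ betaBox (n + 1) R i ∩ A := by
    intro x hx
    refine ⟨hx.1, ?_⟩
    simp only [hA, Set.mem_setOf_eq]
    rw [hw]
    exact le_trans hx.2 hΛ
  have hmono : ∫ x in Q, ΨJ x ^ 2 ≤ ∫ x in betaBox (n + 1) R i ∩ A, ΨJ x ^ 2 :=
    setIntegral_mono_set ((integrableOn_betaBox_of_continuous hcontJ hR1 i).mono_set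
      Set.inter_subset_left) (ae_of_all _ fun x => sq_nonneg _) (ae_of_all _ hQsub)
  -- Step 6: the marginal bound on `Q`
  have hFz : ∀ x u, 2 < u → F (Function.update x i u) = 0 := by
    intro x u hu
    by_contra hne
    have hmem := hF.support_subset hne
    have h1 : Function.update x i u i ≤ ∑ j, Function.update x i u j :=
      Finset.single_le_sum (fun j _ => hmem.1 j) (Finset.mem_univ i)
    rw [Function.update_self] at h1
    linarith [hmem.2]
  have hGz : ∀ x u, 2 < u → G (Function.update x i u) = 0 := fun x u hu =>
    tensorSum_update_eq_zero hδ c x i (hS₀.trans hu.le)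
  have hGa : ∀ x, ∫ u in Set.Ioi 0, G (Function.update x i u) = ΨJ x := fun x =>
    setIntegral_Ioi_tensorSum_update hδ hR0 J c i (fun l hl => (hterm l hl i).trans (hS₀.trans h2R)) x
  have hmarg := marginal_sq_bound i h2R hF.measurable (tensorSum_continuous δ J c) hF1
    (integrable_sq_of_isPolymathTestFunction hF) hFz hGz (marginalSum_continuous δ R i J c) hGa
    (Set.inter_subset_left) hQm hτ
  have hJi : polymathJ (n + 1) (1 - ε) i F = ∫ x in Q, (∫ u in Set.Ioi 0, F (Function.update x i u)) ^ 2 :=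
    polymathJ_eq_integral_betaBox hε0.le F hR1 i
  -- Step 7: combine
  have hτ1 : 0 < 1 + τ := by linarith
  have hQge : (polymathJ (n + 1) (1 - ε) i F - (1 + 1 / τ) * (2 * (2 * Δ))) / (1 + τ) ≤ ∫ x in Q, ΨJ x ^ 2 := by
    rw [div_le_iff₀ hτ1, hJi]
    linarith [hmarg]
  have hB2 : 0 ≤ 2 * (2 * B) * (2 * B) := by positivity
  calc (polymathJ (n + 1) (1 - ε) i F - (1 + 1 / τ) * (2 * (2 * Δ))) / (1 + τ) -
        2 * (2 * B) * (2 * B) * (2 * n * δ * R ^ n)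
      ≤ (∫ x in betaBox (n + 1) R i ∩ A, ΨJ x ^ 2) -
          2 * (2 * B) * (2 * B) * (volume (betaBox (n + 1) R i ∩ Sh)).toReal := by
        nlinarith [hQge, hmono, hshell, mul_le_mul_of_nonneg_left hshell hB2]
    _ ≤ ∫ x in betaBox (n + 1) R i, (Ψ₁ x + 2 * Ψ₂ x) * Ψ₁ x := by rw [← hsplit]; exact hint_lower

end Beta

/-! ### Helpers for the assembly -/

section Helpers

variable {n : ℕ}

/-- **Pigeonhole** (p. 22: "from the pigeonhole principle we have `Σ_{i ≠ i₀} (…) < ϑ` for some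
`i₀`"): if `Σ_i a_i < ((n+1)/n) θ` over `Fin (n+1)` then `Σ_{i ≠ i₀} a_i < θ` for some `i₀`. [cite: Polymath8b2014, Theorem 3.13 (proof, §5.3, p. 22)] -/
theorem exists_sum_erase_lt (hn : 1 ≤ n) (a : Fin (n + 1) → ℝ) {θ : ℝ}
    (h : ∑ i, a i < (n + 1 : ℝ) / n * θ) : ∃ i₀, ∑ i ∈ univ.erase i₀, a i < θ := by
  by_contra hno
  push Not at hno
  have hnpos : (0 : ℝ) < n := by exact_mod_cast (show 0 < n by omega)
  have hsum : ∑ i₀ : Fin (n + 1), ∑ i ∈ univ.erase i₀, a i = n * ∑ i, a i := by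
    rw [Finset.sum_congr rfl fun i₀ _ => Finset.sum_erase_eq_sub (Finset.mem_univ i₀),
      Finset.sum_sub_distrib, Finset.sum_const, Finset.card_univ, Fintype.card_fin, nsmul_eq_mul]
    push_cast
    ring
  have hge : ((n + 1 : ℕ) : ℝ) * θ ≤ ∑ i₀ : Fin (n + 1), ∑ i ∈ univ.erase i₀, a i := by
    have := Finset.sum_le_sum fun i₀ (_ : i₀ ∈ (univ : Finset (Fin (n + 1)))) => hno i₀
    rwa [Finset.sum_const, Finset.card_univ, Fintype.card_fin, nsmul_eq_mul] at this
  rw [hsum] at hge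
  have h2 : (n : ℝ) * ∑ i, a i < n * ((n + 1 : ℝ) / n * θ) := mul_lt_mul_of_pos_left h hnpos
  have h3 : (n : ℝ) * ((n + 1 : ℝ) / n * θ) = (n + 1) * θ := by field_simp
  rw [h3] at h2
  push_cast at hge
  linarith

/-- A bounded measurable function supported on `r·R_k` with `I(F) > 0` is a test function of
support parameter `r - 1`. [folklore] -/
theorem isPolymathTestFunction_of_bounded {k : ℕ} {F : (Fin k → ℝ) → ℝ} (hFm : Measurable F)
    {C : ℝ} (hC : ∀ t, |F t| ≤ C) {r : ℝ} (hFs : Function.support F ⊆ scaledSimplex k r)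
    (hI : 0 < polymathI k F) : IsPolymathTestFunction k (r - 1) F where
  measurable := hFm
  support_subset := by rw [show 1 + (r - 1) = r by ring]; exact hFs
  integrableOn_sq := by
    rw [show 1 + (r - 1) = r by ring]
    have hsub : scaledSimplex k r ⊆ Set.Icc (0 : Fin k → ℝ) (fun _ => r) := fun x hx =>
      ⟨fun i => hx.1 i, fun i => (Finset.single_le_sum (fun j _ => hx.1 j) (Finset.mem_univ i)).trans hx.2⟩
    have hvol : volume (scaledSimplex k r) < ⊤ := lt_of_le_of_lt (measure_mono hsub) measure_Icc_lt_top
    refine IntegrableOn.of_bound hvol ((hFm.pow_const 2).aestronglyMeasurable) (C ^ 2)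
      (ae_of_all _ fun t => ?_)
    rw [Real.norm_eq_abs, abs_of_nonneg (sq_nonneg _), ← sq_abs]
    exact pow_le_pow_left₀ (abs_nonneg _) (hC t) 2
  polymathI_pos := hI

/-- `Z(u) = Z(-1)` for `u ≤ -1` (the bump vanishes below `-1`). [folklore] -/
theorem pouTail_of_le_neg_one {u : ℝ} (hu : u ≤ -1) : pouTail u = pouTail (-1) := by
  unfold pouTail
  rw [← intervalIntegral.integral_add_adjacent_intervals (b := -1)
    (pouBump_continuous.intervalIntegrable _ _) (pouBump_continuous.intervalIntegrable _ _)]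
  have h0 : ∫ v in u..(-1), pouBump v = 0 :=
    intervalIntegral.integral_zero_ae (ae_of_all _ fun v hv => by
      rw [Set.uIoc_of_le hu] at hv
      exact pouBump_of_le_neg_one hv.2)
  rw [h0, zero_add]

/-- `f_{l,i}(0)` only depends on `l_i`, and is the constant `ρδ Z(-1)` as soon as `l_i ≥ 1`. [folklore] -/
theorem pouCutoff_zero_of_one_le {ρ δ : ℝ} {k : ℕ} {l : Fin k → ℤ} {i : Fin k} (hl : 1 ≤ l i) :
    pouCutoff ρ δ l i 0 = ρ * δ * pouTail (-1) := by
  rw [pouCutoff_zero, pouTail_of_le_neg_one]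
  have : (1 : ℝ) ≤ (l i : ℝ) := by exact_mod_cast hl
  linarith

/-- **Where non-zero cell averages live**: if `cellAvg δ F l ≠ 0` for `F` supported on `r·R_k`, then
`l ≥ 1` componentwise, `δ(l_i - 1) ≤ r` and `Σ_i δ(l_i + 1) ≤ r + 2kδ`. [folklore] -/
theorem cellAvg_ne_zero_geometry {k : ℕ} {δ : ℝ} (hδ : 0 < δ) {F : (Fin k → ℝ) → ℝ} {r : ℝ}
    (hFs : Function.support F ⊆ scaledSimplex k r) {l : Fin k → ℤ} (hl : cellAvg δ F l ≠ 0) :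
    (∀ i, 1 ≤ l i) ∧ (∀ i, δ * ((l i : ℝ) - 1) ≤ r) ∧ ∑ i, δ * ((l i : ℝ) + 1) ≤ r + 2 * k * δ := by
  obtain ⟨y, hy, hFy⟩ := exists_mem_of_cellAvg_ne_zero hl
  have hys : y ∈ scaledSimplex k r := hFs hFy
  rw [mem_avgCell_iff] at hy
  have hyi : ∀ i, y i ≤ r := fun i =>
    (Finset.single_le_sum (fun j _ => hys.1 j) (Finset.mem_univ i)).trans hys.2
  refine ⟨fun i => ?_, fun i => (hy i).1.trans (hyi i), ?_⟩
  · have h1 : (0 : ℝ) < δ * (l i : ℝ) := lt_of_le_of_lt (hys.1 i) (hy i).2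
    have h2 : (0 : ℝ) < (l i : ℝ) := pos_of_mul_pos_right h1 hδ.le
    exact_mod_cast (show (0 : ℤ) < l i by exact_mod_cast h2)
  · calc ∑ i, δ * ((l i : ℝ) + 1) = ∑ i, (δ * ((l i : ℝ) - 1) + 2 * δ) := by
          refine Finset.sum_congr rfl fun i _ => by ring
      _ ≤ ∑ i, (y i + 2 * δ) := Finset.sum_le_sum fun i _ => by linarith [(hy i).1]
      _ = ∑ i, y i + 2 * k * δ := by
          rw [Finset.sum_add_distrib, Finset.sum_const, Finset.card_univ, Fintype.card_fin,
            nsmul_eq_mul]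
          ring
      _ ≤ r + 2 * k * δ := by linarith [hys.2]

/-- **(C')** The `L²` error of the averaged quasi-interpolant: with `G = Σ_{l ∈ box} (cellAvg δ F l) T_l`,
`Δ = ∫_{box} (G - F)² ≤ 3 (2^k η + ω² R^k + η)` when `F̃` is continuous with `∫ (F̃ - F)² ≤ η` and
modulus of continuity `ω` at scale `2δ`. [cite: Polymath8b2014, Theorem 3.14 (proof, §5.4, p. 23)] -/
theorem sq_error_le_cellAvg {k : ℕ} {δ : ℝ} (hδ : 0 < δ) {L : ℕ} {R : ℝ} (hR : 0 ≤ R) (hRL : R / δ ≤ L)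
    {F Ft : (Fin k → ℝ) → ℝ} (hFm : Measurable F) (hF2 : Integrable fun x => F x ^ 2)
    (hFtc : Continuous Ft) (hdint : Integrable fun x => (Ft x - F x) ^ 2) {w η : ℝ}
    (hω : ∀ x y : Fin k → ℝ, (∀ i, |y i - x i| ≤ 2 * δ) → |Ft y - Ft x| ≤ w)
    (hη : ∫ x, (Ft x - F x) ^ 2 ≤ η) :
    IntegrableOn (fun x => (tensorSum δ (indexBox k L) (cellAvg δ F) x - F x) ^ 2) (ioBox k R) ∧
      ∫ x in ioBox k R, (tensorSum δ (indexBox k L) (cellAvg δ F) x - F x) ^ 2 ≤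
        3 * (2 ^ k * η + w ^ 2 * R ^ k + η) := by
  set G := tensorSum δ (indexBox k L) (cellAvg δ F) with hGdef
  have hGc : Continuous G := tensorSum_continuous δ _ _
  have hvol : volume (ioBox k R) < ⊤ :=
    lt_of_le_of_lt (measure_mono (ioBox_subset_Icc R)) measure_Icc_lt_top
  -- integrability of `(G - F)²` on the box
  have hint : IntegrableOn (fun x => (G x - F x) ^ 2) (ioBox k R) := by
    have h1 : IntegrableOn (fun x => 2 * G x ^ 2 + 2 * F x ^ 2) (ioBox k R) :=
      (integrableOn_ioBox_of_continuous (by fun_prop : Continuous fun x => 2 * G x ^ 2) R).add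
        ((hF2.const_mul 2).integrableOn)
    refine h1.mono' (((hGc.measurable.sub hFm).pow_const 2).aestronglyMeasurable) (ae_of_all _ fun x => ?_)
    rw [Real.norm_eq_abs, abs_of_nonneg (sq_nonneg _)]
    nlinarith [sq_nonneg (G x + F x)]
  refine ⟨hint, ?_⟩
  -- the decomposition `G - F = A(F - Ft) + (A Ft - Ft) + (Ft - F)`
  set D : (Fin k → ℝ) → ℝ := fun y => F y - Ft y with hD
  have hDm : AEStronglyMeasurable D volume := (hFm.sub hFtc.measurable).aestronglyMeasurable
  have hD2 : Integrable fun y => D y ^ 2 := by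
    refine hdint.congr (ae_of_all _ fun y => ?_)
    simp only [hD]; ring
  have hFcell : ∀ l : Fin k → ℤ, IntegrableOn F (avgCell δ l) := by
    intro l
    have hmem : MemLp F 2 (volume.restrict (avgCell δ l)) :=
      (memLp_two_iff_integrable_sq hFm.aestronglyMeasurable.restrict).2 hF2.integrableOn
    haveI : IsFiniteMeasure (volume.restrict (avgCell δ l)) :=
      isFiniteMeasure_restrict.2 (volume_avgCell_lt_top hδ.le l).ne
    exact hmem.integrable one_le_two
  have hFtcell : ∀ l : Fin k → ℤ, IntegrableOn Ft (avgCell δ l) := fun l =>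
    (hFtc.continuousOn.integrableOn_compact isCompact_Icc).mono_set (avgCell_subset_Icc δ l)
  have hsplit : ∀ x, G x = tensorSum δ (indexBox k L) (cellAvg δ D) x +
      tensorSum δ (indexBox k L) (cellAvg δ Ft) x := by
    intro x
    simp only [hGdef, tensorSum, ← Finset.sum_add_distrib]
    refine Finset.sum_congr rfl fun l _ => ?_
    rw [hD, cellAvg_sub (hFcell l) (hFtcell l)]
    ring
  -- the three error terms
  set T1 := tensorSum δ (indexBox k L) (cellAvg δ D) with hT1
  set T2 : (Fin k → ℝ) → ℝ := fun x => tensorSum δ (indexBox k L) (cellAvg δ Ft) x - Ft x with hT2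
  set T3 : (Fin k → ℝ) → ℝ := fun x => Ft x - F x with hT3
  have hT1c : Continuous T1 := tensorSum_continuous δ _ _
  have hT2c : Continuous T2 := (tensorSum_continuous δ _ _).sub hFtc
  have hpt : ∀ x, (G x - F x) ^ 2 ≤ 3 * (T1 x ^ 2 + T2 x ^ 2 + T3 x ^ 2) := by
    intro x
    have : G x - F x = T1 x + T2 x + T3 x := by rw [hsplit x]; simp only [hT1, hT2, hT3]; ring
    rw [this]
    nlinarith [sq_nonneg (T1 x - T2 x), sq_nonneg (T2 x - T3 x), sq_nonneg (T1 x - T3 x)]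
  have hi1 : IntegrableOn (fun x => T1 x ^ 2) (ioBox k R) := integrableOn_ioBox_of_continuous (hT1c.pow 2) R
  have hi2 : IntegrableOn (fun x => T2 x ^ 2) (ioBox k R) := integrableOn_ioBox_of_continuous (hT2c.pow 2) R
  have hi3 : IntegrableOn (fun x => T3 x ^ 2) (ioBox k R) := hdint.integrableOn
  have hi123 : IntegrableOn (fun x => 3 * (T1 x ^ 2 + T2 x ^ 2 + T3 x ^ 2)) (ioBox k R) :=
    ((hi1.add hi2).add hi3).const_mul 3
  -- bounds for the three terms
  have hbox : ∀ x ∈ ioBox k R, ∀ i, -(L : ℝ) ≤ x i / δ ∧ x i / δ ≤ L := by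
    intro x hx i
    rw [ioBox, Set.mem_univ_pi] at hx
    constructor
    · have : 0 ≤ x i / δ := div_nonneg (hx i).1.le hδ.le
      linarith [(Nat.cast_nonneg L : (0 : ℝ) ≤ L)]
    · exact (div_le_div_of_nonneg_right (hx i).2 hδ.le).trans hRL
  have hB1 : ∫ x in ioBox k R, T1 x ^ 2 ≤ 2 ^ k * η := by
    have h := integral_sq_tensorSum_cellAvg_le hδ (Finset.Subset.refl _) hRL hDm hD2
    refine h.trans (mul_le_mul_of_nonneg_left ?_ (by positivity))
    calc ∫ y, D y ^ 2 = ∫ y, (Ft y - F y) ^ 2 := integral_congr_ae (ae_of_all _ fun y => by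
            simp only [hD]; ring)
      _ ≤ η := hη
  have hB2 : ∫ x in ioBox k R, T2 x ^ 2 ≤ w ^ 2 * R ^ k := by
    calc ∫ x in ioBox k R, T2 x ^ 2 ≤ ∫ x in ioBox k R, w ^ 2 :=
          setIntegral_mono_on hi2 (integrableOn_const hvol.ne) (measurableSet_ioBox R) fun x hx => by
            have := abs_tensorSum_cellAvg_sub_le hδ hFtc (hbox x hx) (hω x)
            rw [← sq_abs]
            exact pow_le_pow_left₀ (abs_nonneg _) this 2
      _ = w ^ 2 * R ^ k := by
          rw [setIntegral_const, smul_eq_mul, measureReal_def, volume_ioBox_toReal hR, mul_comm]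
  have hB3 : ∫ x in ioBox k R, T3 x ^ 2 ≤ η :=
    (setIntegral_le_integral hdint (ae_of_all _ fun x => sq_nonneg _)).trans hη
  calc ∫ x in ioBox k R, (G x - F x) ^ 2
      ≤ ∫ x in ioBox k R, 3 * (T1 x ^ 2 + T2 x ^ 2 + T3 x ^ 2) :=
        setIntegral_mono_on hint hi123 (measurableSet_ioBox R) fun x _ => hpt x
    _ = 3 * ((∫ x in ioBox k R, T1 x ^ 2) + (∫ x in ioBox k R, T2 x ^ 2) +
          ∫ x in ioBox k R, T3 x ^ 2) := by
        have hi12 : IntegrableOn (fun x => T1 x ^ 2 + T2 x ^ 2) (ioBox k R) := hi1.add hi2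
        rw [integral_const_mul, integral_add hi12 hi3, integral_add hi1 hi2]
    _ ≤ 3 * (2 ^ k * η + w ^ 2 * R ^ k + η) := by nlinarith [hB1, hB2, hB3]

end Helpers

/-! ### Row sums of the construction -/

section RowSums

variable {n : ℕ}

/-- Membership in the index box is componentwise. [folklore] -/
theorem mem_indexBox_iff {k L : ℕ} {l : Fin k → ℤ} :
    l ∈ indexBox k L ↔ ∀ i, -(L : ℤ) ≤ l i ∧ l i ≤ L := by
  simp [indexBox, Fintype.mem_piFinset]

/-- **The row aggregate of the construction**: over a row of `goodIndex` (indices agreeing with `l`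
off `i₀`), `Σ c_{l₂} f_{l₂,i₀}(0) = ρδ Z(-1) · Σ_{-L ≤ m ≤ L} cellAvg δ F (l[i₀ := m])`, provided every
index with non-zero cell average lies in `goodIndex` (then such indices have `l_{i₀} ≥ 1`). [cite: Polymath8b2014, Theorem 3.14 (proof, §5.4, p. 23)] -/
theorem rowSum_goodIndex_eq {ρ δ : ℝ} (hδ : 0 < δ) {L : ℕ} {S₀ : ℝ} {F : (Fin (n + 1) → ℝ) → ℝ}
    {r : ℝ} (hFs : Function.support F ⊆ scaledSimplex (n + 1) r)
    (hcJ : ∀ l, cellAvg δ F l ≠ 0 → l ∈ goodIndex (n + 1) L δ S₀)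
    (i₀ : Fin (n + 1)) {l : Fin (n + 1) → ℤ} (hl : l ∈ goodIndex (n + 1) L δ S₀) :
    ∑ l₂ ∈ (goodIndex (n + 1) L δ S₀).filter
        (fun l₂ => Function.update l₂ i₀ 0 = Function.update l i₀ 0),
        cellAvg δ F l₂ * pouCutoff ρ δ l₂ i₀ 0 =
      ρ * δ * pouTail (-1) * ∑ m ∈ Finset.Icc (-(L : ℤ)) L, cellAvg δ F (Function.update l i₀ m) := by
  classical
  set P : (Fin (n + 1) → ℤ) → Prop := fun l₂ => Function.update l₂ i₀ 0 = Function.update l i₀ 0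
    with hP
  have hlbox : l ∈ indexBox (n + 1) L := goodIndex_subset L δ S₀ hl
  rw [mem_indexBox_iff] at hlbox
  -- Step 1: extend the sum to the whole box
  have h1 : ∑ l₂ ∈ (goodIndex (n + 1) L δ S₀).filter P, cellAvg δ F l₂ * pouCutoff ρ δ l₂ i₀ 0 =
      ∑ l₂ ∈ (indexBox (n + 1) L).filter P, cellAvg δ F l₂ * pouCutoff ρ δ l₂ i₀ 0 := by
    refine Finset.sum_subset (Finset.filter_subset_filter _ (goodIndex_subset L δ S₀)) ?_
    intro l₂ hl₂ hl₂'
    have hPl : P l₂ := (Finset.mem_filter.1 hl₂).2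
    have hc : cellAvg δ F l₂ = 0 := by
      by_contra hne
      exact hl₂' (Finset.mem_filter.2 ⟨hcJ l₂ hne, hPl⟩)
    rw [hc, zero_mul]
  -- Step 2: the box row is the image of `m ↦ l[i₀ := m]`
  have h2 : (indexBox (n + 1) L).filter P =
      (Finset.Icc (-(L : ℤ)) L).image fun m => Function.update l i₀ m := by
    ext l₂
    simp only [Finset.mem_filter, Finset.mem_image, Finset.mem_Icc, mem_indexBox_iff, hP]
    constructor
    · rintro ⟨hb, hPl⟩
      refine ⟨l₂ i₀, hb i₀, ?_⟩
      funext j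
      by_cases hj : j = i₀
      · subst hj; simp
      · have := congrFun hPl j
        simp only [Function.update_of_ne hj] at this
        rw [Function.update_of_ne hj, ← this]
    · rintro ⟨m, hm, rfl⟩
      refine ⟨fun j => ?_, ?_⟩
      · by_cases hj : j = i₀
        · subst hj; simpa using hm
        · rw [Function.update_of_ne hj]; exact hlbox j
      · simp
  -- Step 3: sum over the image, termwise evaluation
  rw [h1, h2, Finset.sum_image fun m _ m' _ h => by
    have := congrFun h i₀; simpa using this]
  rw [Finset.mul_sum]
  refine Finset.sum_congr rfl fun m _ => ?_
  by_cases hc : cellAvg δ F (Function.update l i₀ m) = 0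
  · rw [hc, zero_mul, mul_zero]
  · have h1m : 1 ≤ Function.update l i₀ m i₀ := (cellAvg_ne_zero_geometry hδ hFs hc).1 i₀
    rw [pouCutoff_zero_of_one_le h1m]
    ring

end RowSums

/-! ### Theorem 3.14: `DHL[k, m+1]` from a cutoff with vanishing marginals (k ≥ 3) -/

section Assembly

set_option maxHeartbeats 1600000 in
/-- **Polymath 8b, Theorem 3.14 (going beyond the epsilon enlargement), from its printed
ingredients.**  Let `k = n + 1 ≥ 3`, `m ≥ 1`, `0 < ε < 1`, `0 < ϑ < 1`; assume the prime asymptotic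
Theorem 3.5(i) (`h35`, the tree's fact, proved), the `GEH` non-prime asymptotic Theorem 3.6(ii) at
level `ϑ` (`h36`: for some `h₀` the supports off `h₀` sum to `< ϑ`, no condition at `h₀`) and
`EH[ϑ]` as `PrimesHaveLevel ϑ` (from `GEH[ϑ]` by Proposition 2.7).  Let `F` be bounded measurable,
supported on `(k/(k-1))·R_k`, with `∫₀^∞ F dt_i = 0` for a.e. `(t_j)_{j≠i} ≥ 0` with
`Σ_{j≠i} t_j > 1 + ε`, `I(F) > 0` and `Σ_i J_{i,1-ε}(F) > (2m/ϑ) I(F)`.  Then `DHL[k, m+1]`.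
Proof (§5.4 made quantitative): cutoffs `f_{l,i} = ρδ Z(·/(ρδ) - l_i)` at scale
`m I/ΣJ < ρ < ϑ/2` with coefficients the cell averages of `F`; `α ≤ ρ^k((1+τ')I + (1+1/τ')Δ)`,
`β_i ≥ ρ^{k+1}((J_i - (1+1/τ)4Δ)/(1+τ) - 32C²nδρ^{-n})`, `Δ` small (`sq_error_le_cellAvg`); the
supports satisfy `Σ_i S(f_{l,i}) < (k/(k-1))ϑ/2` (pigeonhole gives Theorem 3.6(ii) for every pair)
and rows beyond `Σ_{i≠i₀} S > (1+ε)ϑ/2` have vanishing aggregate (`sum_cellAvg_row_eq_zero`), which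
is what `weakDHL_of_tensorWeights_geh_rows` needs.  (`k = 2` is excluded only because the tree's
marginal bound cuts the `t_i`-sections at `2 = k/(k-1)`.) [cite: Polymath8b2014, Theorem 3.14 (proof, §5.4, p. 23)] -/
theorem weakDHL_of_vanishingMarginals (h35 : theta_divisorSumWeights_asymptotic) {θ : ℝ}
    (h36 : ∀ (H : Finset ℤ), IsAdmissibleTuple H → 1 ≤ #H →
      ∀ (b : ℝ → ℤ), (∀ x, ∀ h ∈ H, Int.gcd (b x + h) (polymathW x) = 1) →
      ∀ h₀ ∈ H, ∀ (F G : ℤ → ℝ → ℝ) (sF sG : ℤ → ℝ),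
        (∀ h ∈ H, IsSieveCutoff (F h) (sF h)) → (∀ h ∈ H, IsSieveCutoff (G h) (sG h)) →
        ∑ h ∈ H.erase h₀, (sF h + sG h) < θ →
        (fun x : ℝ => ∑ n ∈ polymathRange x (b x),
              ∏ h ∈ H, (divisorSumWeight (F h) x ((n : ℤ) + h).toNat *
                divisorSumWeight (G h) x ((n : ℤ) + h).toNat)
            - (∏ h ∈ H, ∫ t in (0 : ℝ)..1, deriv (F h) t * deriv (G h) t) *
              (x / (polymathB x ^ #H * polymathW x)))
          =o[atTop] fun x : ℝ => x / (polymathB x ^ #H * polymathW x))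
    {n m : ℕ} (hn : 2 ≤ n) (hm : 1 ≤ m) (hθ0 : 0 < θ) (hθ1 : θ < 1) (hθ : PrimesHaveLevel θ)
    {ε : ℝ} (hε0 : 0 < ε) (hε1 : ε < 1)
    {F : (Fin (n + 1) → ℝ) → ℝ} (hFm : Measurable F) {C : ℝ} (hC : ∀ t, |F t| ≤ C)
    (hFs : Function.support F ⊆ scaledSimplex (n + 1) ((n + 1 : ℝ) / n))
    (hmarg : ∀ i : Fin (n + 1), ∀ᵐ t' : Fin n → ℝ, (∀ j, 0 ≤ t' j) → 1 + ε < ∑ j, t' j →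
        ∫ u in Set.Ioi 0, F (Fin.insertNth i u t') = 0)
    (hIpos : 0 < polymathI (n + 1) F)
    (hratio : 2 * (m : ℝ) / θ * polymathI (n + 1) F < ∑ i, polymathJ (n + 1) (1 - ε) i F) :
    WeakDicksonHardyLittlewood (n + 1) (m + 1) := by
  classical
  have hn1 : 1 ≤ n := by omega
  have hnpos : (0 : ℝ) < n := by exact_mod_cast (show 0 < n by omega)
  have hn2 : (2 : ℝ) ≤ n := by exact_mod_cast hn
  -- the support radius `S = k/(k-1)`
  obtain ⟨S, hSdef⟩ : ∃ S : ℝ, S = (n + 1 : ℝ) / n := ⟨_, rfl⟩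
  have hS1 : 1 ≤ S := by rw [hSdef, le_div_iff₀ hnpos]; linarith
  have hS32 : S ≤ 3 / 2 := by rw [hSdef, div_le_iff₀ hnpos]; linarith
  rw [← hSdef] at hFs
  have hF : IsPolymathTestFunction (n + 1) (S - 1) F := isPolymathTestFunction_of_bounded hFm hC hFs hIpos
  have hC0 : 0 ≤ C := (abs_nonneg _).trans (hC 0)
  -- the basic quantities `I₀`, `Jsum`
  obtain ⟨I₀, hI₀⟩ : ∃ I₀ : ℝ, I₀ = polymathI (n + 1) F := ⟨_, rfl⟩
  obtain ⟨Jsum, hJsum⟩ : ∃ J : ℝ, J = ∑ i, polymathJ (n + 1) (1 - ε) i F := ⟨_, rfl⟩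
  have hI₀pos : 0 < I₀ := by rw [hI₀]; exact hIpos
  have hJI : 2 * (m : ℝ) / θ * I₀ < Jsum := by rw [hJsum, hI₀]; exact hratio
  have hmpos : (0 : ℝ) < m := by exact_mod_cast hm
  have hJpos : 0 < Jsum := lt_trans (by positivity) hJI
  -- `ρ` strictly between `m I₀ / Jsum` and `θ/2`
  obtain ⟨ρ, hρdef⟩ : ∃ ρ : ℝ, ρ = (m * I₀ / Jsum + θ / 2) / 2 := ⟨_, rfl⟩
  have hlow : (m : ℝ) * I₀ / Jsum < θ / 2 := by
    rw [div_lt_iff₀ hJpos]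
    have h1 := mul_lt_mul_of_pos_left hJI hθ0
    have h2 : θ * (2 * (m : ℝ) / θ * I₀) = 2 * (m * I₀) := by field_simp
    rw [h2] at h1
    linarith only [h1]
  have hρgt : (m : ℝ) * I₀ / Jsum < ρ := by rw [hρdef]; linarith only [hlow]
  have hρlt : ρ < θ / 2 := by rw [hρdef]; linarith only [hlow]
  have hρpos : 0 < ρ := lt_of_le_of_lt (by positivity) hρgt
  have hg : 0 < ρ * Jsum - m * I₀ := by
    have := (div_lt_iff₀ hJpos).1 hρgt
    linarith only [this]
  obtain ⟨g, hgdef⟩ : ∃ g : ℝ, g = ρ * Jsum - m * I₀ := ⟨_, rfl⟩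
  have hgpos : 0 < g := by rw [hgdef]; exact hg
  have h2R : 2 ≤ 1 / ρ := by
    rw [le_div_iff₀ hρpos]; linarith only [hρlt, hθ1]
  have hRpos : 0 < 1 / ρ := by positivity
  have hR1ε : 1 + (S - 1) ≤ 1 / ρ := by linarith only [h2R, hS32]
  have hε2 : 1 + (S - 1) ≤ 2 := by linarith only [hS32]
  -- slacks: `γ` for the supports, `Λ`, `Λ'` for the two thresholds
  obtain ⟨γ, hγdef⟩ : ∃ γ : ℝ, γ = S * θ / 2 - ρ * S := ⟨_, rfl⟩
  have hγpos : 0 < γ := by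
    have h2 : S * θ / 2 - ρ * S = S * (θ / 2 - ρ) := by ring
    rw [hγdef, h2]
    exact mul_pos (by linarith only [hS1]) (by linarith only [hρlt])
  obtain ⟨Λ, hΛdef⟩ : ∃ L : ℝ, L = (1 - ε) * θ / (2 * ρ) := ⟨_, rfl⟩
  have hΛgt : 1 - ε < Λ := by
    rw [hΛdef, lt_div_iff₀ (by positivity)]
    have := mul_lt_mul_of_pos_left (show 2 * ρ < θ by linarith only [hρlt])
      (show (0 : ℝ) < 1 - ε by linarith only [hε1])
    linarith only [this]
  obtain ⟨Λ', hΛ'def⟩ : ∃ L : ℝ, L = (1 + ε) * θ / (2 * ρ) := ⟨_, rfl⟩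
  have hΛ'gt : 1 + ε < Λ' := by
    rw [hΛ'def, lt_div_iff₀ (by positivity)]
    have := mul_lt_mul_of_pos_left (show 2 * ρ < θ by linarith only [hρlt])
      (show (0 : ℝ) < 1 + ε by linarith only [hε0])
    linarith only [this]
  -- `τ'`, `τ`, `CΔ`, `η`, `w₀`
  obtain ⟨τ', hτ'def⟩ : ∃ t : ℝ, t = g / (5 * m * I₀) := ⟨_, rfl⟩
  have hτ'pos : 0 < τ' := by rw [hτ'def]; positivity
  have hτ'I : m * τ' * I₀ = g / 5 := by rw [hτ'def]; field_simp
  obtain ⟨τ, hτdef⟩ : ∃ t : ℝ, t = g / (5 * ρ * Jsum) := ⟨_, rfl⟩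
  have hτpos : 0 < τ := by rw [hτdef]; positivity
  have hτJ : ρ * Jsum * τ = g / 5 := by rw [hτdef]; field_simp
  obtain ⟨CΔ, hCΔdef⟩ : ∃ C : ℝ, C = m * (1 + 1 / τ') + ρ * (n + 1) * (1 + 1 / τ) * 4 := ⟨_, rfl⟩
  have hCΔpos : 0 < CΔ := by rw [hCΔdef]; positivity
  obtain ⟨η, hηdef⟩ : ∃ e : ℝ, e = g / (30 * (2 ^ (n + 1) + 1) * CΔ) := ⟨_, rfl⟩
  have hηpos : 0 < η := by rw [hηdef]; positivity
  have hηCΔ : 3 * (2 ^ (n + 1) + 1) * η * CΔ = g / 10 := by rw [hηdef]; field_simp; ring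
  obtain ⟨w₀, hw₀def⟩ : ∃ w : ℝ, w = min 1 (g / (30 * CΔ * (1 / ρ) ^ (n + 1))) := ⟨_, rfl⟩
  have hw₀pos : 0 < w₀ := by rw [hw₀def]; exact lt_min one_pos (by positivity)
  have hw₀sq : w₀ ^ 2 * (1 / ρ) ^ (n + 1) ≤ g / (30 * CΔ) := by
    have h1 : w₀ ≤ 1 := by rw [hw₀def]; exact min_le_left _ _
    have h2 : w₀ ≤ g / (30 * CΔ * (1 / ρ) ^ (n + 1)) := by rw [hw₀def]; exact min_le_right _ _
    have hRk : 0 < (1 / ρ) ^ (n + 1) := by positivity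
    calc w₀ ^ 2 * (1 / ρ) ^ (n + 1) ≤ w₀ * (1 / ρ) ^ (n + 1) := by
          refine mul_le_mul_of_nonneg_right ?_ hRk.le
          rw [sq]; exact mul_le_of_le_one_right hw₀pos.le h1
      _ ≤ g / (30 * CΔ * (1 / ρ) ^ (n + 1)) * (1 / ρ) ^ (n + 1) :=
          mul_le_mul_of_nonneg_right h2 hRk.le
      _ = g / (30 * CΔ) := by field_simp
  -- the continuous approximation `Ft` (only used through `Δ`)
  obtain ⟨Ft, hFtc, hFts, -, hdint, hdle⟩ := exists_continuous_sq_approx hF one_pos hηpos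
  have huc : UniformContinuous Ft := hFts.uniformContinuous_of_continuous hFtc
  obtain ⟨δ₀, hδ₀pos, hδ₀⟩ := Metric.uniformContinuous_iff.1 huc w₀ hw₀pos
  -- `D₅` and `δ`
  obtain ⟨D₅, hD₅def⟩ : ∃ D : ℝ, D = 16 * ρ * (n + 1) * n * C ^ 2 * (1 / ρ) ^ n + 1 := ⟨_, rfl⟩
  have hD₅pos : 0 < D₅ := by rw [hD₅def]; positivity
  obtain ⟨δ, hδdef⟩ : ∃ d : ℝ, d = min (δ₀ / 4) (min (γ / (4 * ρ * (n + 1)))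
    (min ((Λ - (1 - ε)) / (2 * n + 1)) (min ((Λ' - (1 + ε)) / (2 * n + 1))
      (min (1 / (8 * (n + 1))) (g / (5 * D₅)))))) := ⟨_, rfl⟩
  have hδpos : 0 < δ := by
    rw [hδdef]
    refine lt_min (by positivity) (lt_min (by positivity) (lt_min ?_ (lt_min ?_
      (lt_min (by positivity) (by positivity)))))
    · exact div_pos (by linarith only [hΛgt]) (by positivity)
    · exact div_pos (by linarith only [hΛ'gt]) (by positivity)
  have hδ1 : δ ≤ δ₀ / 4 := by rw [hδdef]; exact min_le_left _ _
  have hδ2 : δ ≤ γ / (4 * ρ * (n + 1)) := by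
    rw [hδdef]; exact (min_le_right _ _).trans (min_le_left _ _)
  have hδ3 : δ ≤ (Λ - (1 - ε)) / (2 * n + 1) := by
    rw [hδdef]; exact (min_le_right _ _).trans ((min_le_right _ _).trans (min_le_left _ _))
  have hδ4 : δ ≤ (Λ' - (1 + ε)) / (2 * n + 1) := by
    rw [hδdef]
    exact (min_le_right _ _).trans ((min_le_right _ _).trans ((min_le_right _ _).trans (min_le_left _ _)))
  have hδ5 : δ ≤ 1 / (8 * (n + 1)) := by
    rw [hδdef]
    exact (min_le_right _ _).trans ((min_le_right _ _).trans ((min_le_right _ _).trans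
      ((min_le_right _ _).trans (min_le_left _ _))))
  have hδ6 : δ ≤ g / (5 * D₅) := by
    rw [hδdef]
    exact (min_le_right _ _).trans ((min_le_right _ _).trans ((min_le_right _ _).trans
      ((min_le_right _ _).trans (min_le_right _ _))))
  -- consequences
  have hρδ : 2 * ρ * ((n : ℝ) + 1) * δ ≤ γ / 2 := by
    have := mul_le_mul_of_nonneg_left hδ2 (by positivity : (0 : ℝ) ≤ 2 * ρ * (n + 1))
    calc 2 * ρ * ((n : ℝ) + 1) * δ ≤ 2 * ρ * (n + 1) * (γ / (4 * ρ * (n + 1))) := this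
      _ = γ / 2 := by field_simp; ring
  have hnδ : 2 * (n : ℝ) * δ ≤ Λ - (1 - ε) := by
    have := (le_div_iff₀ (by positivity : (0 : ℝ) < 2 * n + 1)).1 hδ3
    have e : δ * (2 * (n : ℝ) + 1) = 2 * n * δ + δ := by ring
    rw [e] at this
    linarith only [this, hδpos]
  have hnδ' : 2 * (n : ℝ) * δ ≤ Λ' - (1 + ε) := by
    have := (le_div_iff₀ (by positivity : (0 : ℝ) < 2 * n + 1)).1 hδ4
    have e : δ * (2 * (n : ℝ) + 1) = 2 * n * δ + δ := by ring
    rw [e] at this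
    linarith only [this, hδpos]
  have hkδ : 2 * ((n : ℝ) + 1) * δ ≤ 1 / 4 := by
    have := (le_div_iff₀ (by positivity : (0 : ℝ) < 8 * (n + 1))).1 hδ5
    have e : δ * (8 * ((n : ℝ) + 1)) = 4 * (2 * ((n : ℝ) + 1) * δ) := by ring
    rw [e] at this
    linarith only [this]
  have hshellδ : D₅ * δ ≤ g / 5 := by
    have := (le_div_iff₀ (by positivity : (0 : ℝ) < 5 * D₅)).1 hδ6
    have e : δ * (5 * D₅) = 5 * (D₅ * δ) := by ring
    rw [e] at this
    linarith only [this]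
  have hδδ₀ : 2 * δ < δ₀ := by linarith only [hδ1, hδ₀pos]
  -- `L`, `S₀`, the index set and the coefficients
  obtain ⟨L, hLdef⟩ : ∃ L : ℕ, L = ⌈1 / (ρ * δ)⌉₊ + 1 := ⟨_, rfl⟩
  have hL' : 1 / (ρ * δ) + 1 ≤ L := by
    rw [hLdef]; push_cast; linarith only [Nat.le_ceil (1 / (ρ * δ))]
  have hL : 1 / (ρ * δ) ≤ L := by linarith only [hL']
  have hRL : 1 / ρ / δ ≤ L := by rw [div_div]; exact hL
  obtain ⟨S₀, hS₀def⟩ : ∃ s : ℝ, s = S + 2 * ((n : ℝ) + 1) * δ := ⟨_, rfl⟩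
  have hS₀2 : S₀ ≤ 2 := by rw [hS₀def]; linarith only [hkδ, hS32]
  have hρS₀ : ρ * S₀ < S * θ / 2 := by
    rw [hS₀def]
    have : ρ * (S + 2 * ((n : ℝ) + 1) * δ) = ρ * S + 2 * ρ * ((n : ℝ) + 1) * δ := by ring
    rw [this]
    linarith only [hρδ, hγdef, hγpos]
  have hρS₀' : ρ * S₀ < 3 / 4 := by
    have : S * θ / 2 ≤ 3 / 4 := by nlinarith only [hS32, hθ1, hS1, hθ0]
    linarith only [hρS₀, this]
  set J := goodIndex (n + 1) L δ S₀ with hJ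
  set c : (Fin (n + 1) → ℤ) → ℝ := cellAvg δ F with hc
  have hcB : ∀ l ∈ J, |c l| ≤ C := fun l _ => abs_cellAvg_le hδpos hC l
  -- where the non-zero coefficients live
  have hcgeo : ∀ l, c l ≠ 0 → (∀ i, 1 ≤ l i) ∧ (∀ i, δ * ((l i : ℝ) - 1) ≤ S) ∧
      ∑ i, δ * ((l i : ℝ) + 1) ≤ S₀ := by
    intro l hl
    obtain ⟨h1, h2, h3⟩ := cellAvg_ne_zero_geometry hδpos hFs hl
    refine ⟨h1, h2, ?_⟩
    rw [hS₀def]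
    push_cast at h3
    exact h3
  have hSρ : S ≤ 1 / ρ := by linarith only [h2R, hS32]
  have hcJ : ∀ l, c l ≠ 0 → l ∈ J := by
    intro l hl
    obtain ⟨h1, h2, h3⟩ := hcgeo l hl
    simp only [hJ, goodIndex, Finset.mem_filter, mem_indexBox_iff]
    refine ⟨fun i => ⟨by have := h1 i; omega, ?_⟩, fun i => by have := h1 i; omega, h3⟩
    -- `l i ≤ L`: `δ (l i - 1) ≤ S ≤ 1/ρ`
    have hli : (l i : ℝ) ≤ 1 / (ρ * δ) + 1 := by
      have := h2 i
      rw [one_div, mul_inv, ← one_div, ← one_div]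
      have h' : (l i : ℝ) - 1 ≤ S / δ := by rw [le_div_iff₀ hδpos]; linarith only [this]
      have h'' : S / δ ≤ 1 / ρ * (1 / δ) := by
        rw [← div_eq_mul_one_div]; exact div_le_div_of_nonneg_right hSρ hδpos.le
      linarith only [h', h'']
    have : (l i : ℝ) ≤ L := hli.trans hL'
    exact_mod_cast this
  -- `G` on the box equals the full averaged interpolant
  have hGbox : ∀ x, tensorSum δ J c x = tensorSum δ (indexBox (n + 1) L) c x := by
    intro x
    refine Finset.sum_subset (goodIndex_subset L δ S₀) fun l _ hlJ => ?_
    have : c l = 0 := by by_contra h; exact hlJ (hcJ l h)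
    rw [this, zero_mul]
  -- (C') the `L²` error
  have hω : ∀ x y : Fin (n + 1) → ℝ, (∀ i, |y i - x i| ≤ 2 * δ) → |Ft y - Ft x| ≤ w₀ := by
    intro x y hy
    have hdist : dist y x < δ₀ := by
      have : dist y x ≤ 2 * δ := (dist_pi_le_iff (by positivity)).2 fun i => by
        rw [Real.dist_eq]; exact hy i
      linarith only [this, hδδ₀]
    have := hδ₀ hdist
    rw [Real.dist_eq] at this
    exact this.le
  have hF2 : Integrable fun x => F x ^ 2 := integrable_sq_of_isPolymathTestFunction hF
  obtain ⟨hΔint0, hΔle0⟩ := sq_error_le_cellAvg hδpos hRpos.le hRL hFm hF2 hFtc hdint hω hdle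
  have hΔint : IntegrableOn (fun x => (tensorSum δ J c x - F x) ^ 2) (ioBox (n + 1) (1 / ρ)) := by
    simpa only [hGbox] using hΔint0
  obtain ⟨Δ, hΔdef⟩ : ∃ D : ℝ, D = ∫ x in ioBox (n + 1) (1 / ρ), (tensorSum δ J c x - F x) ^ 2 :=
    ⟨_, rfl⟩
  have hΔle : Δ ≤ 3 * (2 ^ (n + 1) * η + w₀ ^ 2 * (1 / ρ) ^ (n + 1) + η) := by
    rw [hΔdef]; simpa only [hGbox] using hΔle0
  have hΔ0 : 0 ≤ Δ := by rw [hΔdef]; exact integral_nonneg fun x => sq_nonneg _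
  have hΔg : CΔ * Δ ≤ g / 5 := by
    have h1 : CΔ * (3 * (2 ^ (n + 1) * η + w₀ ^ 2 * (1 / ρ) ^ (n + 1) + η)) =
        3 * (2 ^ (n + 1) + 1) * η * CΔ + 3 * CΔ * (w₀ ^ 2 * (1 / ρ) ^ (n + 1)) := by ring
    have h2 : 3 * CΔ * (w₀ ^ 2 * (1 / ρ) ^ (n + 1)) ≤ 3 * CΔ * (g / (30 * CΔ)) :=
      mul_le_mul_of_nonneg_left hw₀sq (by positivity)
    have h3 : 3 * CΔ * (g / (30 * CΔ)) = g / 10 := by field_simp; ring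
    calc CΔ * Δ ≤ CΔ * (3 * (2 ^ (n + 1) * η + w₀ ^ 2 * (1 / ρ) ^ (n + 1) + η)) :=
          mul_le_mul_of_nonneg_left hΔle hCΔpos.le
      _ ≤ g / 10 + g / 10 := by rw [h1, hηCΔ]; linarith only [h2, h3]
      _ = g / 5 := by ring
  -- (A)
  have hA := alpha_le hρpos hδpos J c hF hR1ε hΔint hτ'pos
  rw [← hΔdef, ← hI₀] at hA
  -- (B)
  have hF1 : Integrable F := by
    have hmem : MemLp F 2 volume :=
      (memLp_two_iff_integrable_sq hF.measurable.aestronglyMeasurable).2 hF2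
    have hΩ : volume (scaledSimplex (n + 1) (1 + (S - 1))) < ⊤ := by
      refine lt_of_le_of_lt (measure_mono ?_) (measure_Icc_lt_top (a := (0 : Fin (n + 1) → ℝ))
        (b := fun _ => 1 + (S - 1)))
      intro x hx
      refine ⟨fun i => hx.1 i, fun i => ?_⟩
      exact (Finset.single_le_sum (fun j _ => hx.1 j) (Finset.mem_univ i)).trans hx.2
    haveI : IsFiniteMeasure (volume.restrict (scaledSimplex (n + 1) (1 + (S - 1)))) :=
      isFiniteMeasure_restrict.2 hΩ.ne
    have hint : IntegrableOn F (scaledSimplex (n + 1) (1 + (S - 1))) :=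
      (hmem.restrict _).integrable one_le_two
    exact hint.integrable_of_forall_notMem_eq_zero fun x hx => by
      by_contra h; exact hx (hF.support_subset h)
  have hΛ' : 1 - ε ≤ (1 - ε) * θ / (2 * ρ) - 2 * n * δ := by rw [← hΛdef]; linarith only [hnδ, hΛgt]
  set J₁ : Fin (n + 1) → Finset (Fin (n + 1) → ℤ) := fun i₁ => J.filter fun l =>
    ∑ j ∈ univ.erase i₁, ρ * δ * ((l j : ℝ) + 1) < (1 - ε) * θ / 2 with hJ₁
  have hB' : ∀ i : Fin (n + 1), ρ ^ (n + 1 + 1) * ((polymathJ (n + 1) (1 - ε) i F -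
      (1 + 1 / τ) * (2 * (2 * Δ))) / (1 + τ) - 2 * (2 * C) * (2 * C) * (2 * n * δ * (1 / ρ) ^ n)) ≤
      tensorBeta J c (fun i l => pouCutoff ρ δ l i) J₁ i := by
    intro i
    have h := beta_ge' (θ := θ) hε0 hρpos hδpos h2R hL hS₀2 hn1 hΛ' c hC0 hcB hF hF1 hε2 hτpos i
    rw [← hΔdef] at h
    exact h
  -- summing (B) over `i`
  have hsum_eq : ∑ i : Fin (n + 1), ρ ^ (n + 1 + 1) * ((polymathJ (n + 1) (1 - ε) i F -
      (1 + 1 / τ) * (2 * (2 * Δ))) / (1 + τ) - 2 * (2 * C) * (2 * C) * (2 * n * δ * (1 / ρ) ^ n)) =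
      ρ ^ (n + 1 + 1) * ((Jsum - (n + 1) * ((1 + 1 / τ) * (2 * (2 * Δ)))) / (1 + τ) -
        (n + 1) * (2 * (2 * C) * (2 * C) * (2 * n * δ * (1 / ρ) ^ n))) := by
    rw [← Finset.mul_sum, Finset.sum_sub_distrib, Finset.sum_const, Finset.card_univ,
      Fintype.card_fin, nsmul_eq_mul, ← Finset.sum_div, Finset.sum_sub_distrib, Finset.sum_const,
      Finset.card_univ, Fintype.card_fin, nsmul_eq_mul, ← hJsum]
    push_cast
    ring
  have hsumB : ρ ^ (n + 1 + 1) * ((Jsum - (n + 1) * ((1 + 1 / τ) * (2 * (2 * Δ)))) / (1 + τ) -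
      (n + 1) * (2 * (2 * C) * (2 * C) * (2 * n * δ * (1 / ρ) ^ n))) ≤
      ∑ i₀, tensorBeta J c (fun i l => pouCutoff ρ δ l i) J₁ i₀ := by
    rw [← hsum_eq]
    exact Finset.sum_le_sum fun i _ => hB' i
  -- final arithmetic: the key inequality
  have hρk : 0 < ρ ^ (n + 1) := pow_pos hρpos _
  have hτ1 : 0 < 1 + τ := by linarith only [hτpos]
  have hfrac : ρ * Jsum - g / 5 ≤ ρ * Jsum / (1 + τ) := by
    rw [le_div_iff₀ hτ1]
    have e : (ρ * Jsum - g / 5) * (1 + τ) = ρ * Jsum + ρ * Jsum * τ - g / 5 - g / 5 * τ := by ring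
    rw [e, hτJ]
    have := mul_pos hgpos hτpos
    linarith only [this]
  have hX0 : 0 ≤ ((n : ℝ) + 1) * ((1 + 1 / τ) * (2 * (2 * Δ))) :=
    mul_nonneg (by positivity) (mul_nonneg (by positivity) (by linarith only [hΔ0]))
  have hfrac2 : ρ * Jsum - g / 5 - ρ * ((n + 1) * ((1 + 1 / τ) * (2 * (2 * Δ)))) ≤
      ρ * ((Jsum - (n + 1) * ((1 + 1 / τ) * (2 * (2 * Δ)))) / (1 + τ)) := by
    rw [sub_div, mul_sub]
    have h1 : ρ * ((n + 1) * ((1 + 1 / τ) * (2 * (2 * Δ))) / (1 + τ)) ≤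
        ρ * ((n + 1) * ((1 + 1 / τ) * (2 * (2 * Δ)))) := by
      refine mul_le_mul_of_nonneg_left ?_ hρpos.le
      rw [div_le_iff₀ hτ1]
      have := mul_nonneg hX0 hτpos.le
      linarith only [this]
    have h2 : ρ * (Jsum / (1 + τ)) = ρ * Jsum / (1 + τ) := by ring
    linarith only [h1, h2, hfrac]
  have hshell : ρ * ((n + 1) * (2 * (2 * C) * (2 * C) * (2 * n * δ * (1 / ρ) ^ n))) ≤ g / 5 := by
    have e : ρ * ((n + 1) * (2 * (2 * C) * (2 * C) * (2 * n * δ * (1 / ρ) ^ n))) =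
        (16 * ρ * (n + 1) * n * C ^ 2 * (1 / ρ) ^ n) * δ := by ring
    rw [e]
    have hle : (16 * ρ * (n + 1) * n * C ^ 2 * (1 / ρ) ^ n) * δ ≤ D₅ * δ :=
      mul_le_mul_of_nonneg_right (by rw [hD₅def]; linarith only) hδpos.le
    linarith only [hle, hshellδ]
  have hΔsplit : (m : ℝ) * ((1 + 1 / τ') * Δ) + ρ * ((n + 1) * ((1 + 1 / τ) * (2 * (2 * Δ)))) =
      CΔ * Δ := by
    rw [hCΔdef]; ring
  have hgI : ρ * Jsum - m * I₀ = g := by rw [hgdef]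
  have key : (m : ℝ) * ((1 + τ') * I₀ + (1 + 1 / τ') * Δ) <
      ρ * ((Jsum - (n + 1) * ((1 + 1 / τ) * (2 * (2 * Δ)))) / (1 + τ) -
        (n + 1) * (2 * (2 * C) * (2 * C) * (2 * n * δ * (1 / ρ) ^ n))) := by
    have hexp : (m : ℝ) * ((1 + τ') * I₀ + (1 + 1 / τ') * Δ) =
        m * I₀ + m * τ' * I₀ + m * ((1 + 1 / τ') * Δ) := by ring
    rw [hexp, hτ'I, mul_sub]
    linarith only [hΔg, hfrac2, hshell, hΔsplit, hgI, hgpos]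
  have hkey : (m : ℝ) * tensorAlpha J c (fun i l => pouCutoff ρ δ l i) <
      ∑ i₀, tensorBeta J c (fun i l => pouCutoff ρ δ l i) J₁ i₀ := by
    calc (m : ℝ) * tensorAlpha J c (fun i l => pouCutoff ρ δ l i)
        ≤ m * (ρ ^ (n + 1) * ((1 + τ') * I₀ + (1 + 1 / τ') * Δ)) :=
          mul_le_mul_of_nonneg_left hA hmpos.le
      _ = ρ ^ (n + 1) * (m * ((1 + τ') * I₀ + (1 + 1 / τ') * Δ)) := by ring
      _ < ρ ^ (n + 1) * (ρ * ((Jsum - (n + 1) * ((1 + 1 / τ) * (2 * (2 * Δ)))) / (1 + τ) -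
          (n + 1) * (2 * (2 * C) * (2 * C) * (2 * n * δ * (1 / ρ) ^ n)))) :=
          mul_lt_mul_of_pos_left key hρk
      _ = ρ ^ (n + 1 + 1) * ((Jsum - (n + 1) * ((1 + 1 / τ) * (2 * (2 * Δ)))) / (1 + τ) -
          (n + 1) * (2 * (2 * C) * (2 * C) * (2 * n * δ * (1 / ρ) ^ n))) := by ring
      _ ≤ _ := hsumB
  -- the supports
  have hterm : ∀ l ∈ J, ∀ i, ρ * δ * ((l i : ℝ) + 1) ≤ ρ * S₀ := fun l hl i => by
    have := term_le_of_mem_goodIndex hδpos.le hl i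
    have e : ρ * δ * ((l i : ℝ) + 1) = ρ * (δ * ((l i : ℝ) + 1)) := by ring
    rw [e]
    exact mul_le_mul_of_nonneg_left this hρpos.le
  have hsumJ : ∀ l ∈ J, ∑ i, ρ * δ * ((l i : ℝ) + 1) ≤ ρ * S₀ := fun l hl => by
    have hfac : ∑ i, ρ * δ * ((l i : ℝ) + 1) = ρ * ∑ i, δ * ((l i : ℝ) + 1) := by
      rw [Finset.mul_sum]; refine Finset.sum_congr rfl fun i _ => by ring
    rw [hfac]
    exact mul_le_mul_of_nonneg_left (sum_le_of_mem_goodIndex hl) hρpos.le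
  have hSθ : S * θ / 2 + S * θ / 2 = (n + 1 : ℝ) / n * θ := by rw [hSdef]; ring
  -- apply the `DHL` deduction with row cancellation
  refine weakDHL_of_tensorWeights_geh_rows (κ := Fin (n + 1) → ℤ) h35 h36 (by omega : 2 ≤ n + 1)
    hm hθ0 hθ1 hθ J c (fun i l => pouCutoff ρ δ l i) (fun i l => ρ * δ * ((l i : ℝ) + 1)) J₁
    (fun i => Finset.filter_subset _ _) (fun i₀ l => Function.update l i₀ 0)
    ?_ ?_ ?_ ?_ ?_ ?_ hkey
  · -- `hrowf`: the cutoffs off `i₀` only depend on the row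
    intro i₀ i hi l _ l₂ _ hr
    have : l i = l₂ i := by
      have := congrFun hr i
      simpa only [Function.update_of_ne hi] using this
    funext t
    simp only [pouCutoff, this]
  · -- `hrowJ₁`: membership in `𝒥₁(i₀)` only depends on the row
    intro i₀ l _ l₂ hl₂ hr hl1
    rw [hJ₁, Finset.mem_filter] at hl1 ⊢
    refine ⟨hl₂, ?_⟩
    have heq : ∀ j ∈ univ.erase i₀, (l₂ j : ℝ) = l j := fun j hj => by
      have hne : j ≠ i₀ := Finset.ne_of_mem_erase hj
      have := congrFun hr j
      simp only [Function.update_of_ne hne] at this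
      exact_mod_cast this.symm
    rw [Finset.sum_congr rfl fun j hj => by rw [heq j hj]]
    exact hl1.2
  · -- `hf`
    intro i l hl
    exact pouCutoff_isSieveCutoff hρpos hδpos l i (by have := nonneg_of_mem_goodIndex hl i; omega)
  · -- `hs1`: pigeonhole from `Σ_i (S(f_{l,i}) + S(f_{l',i})) < (k/(k-1)) θ`
    intro l hl l' hl'
    refine exists_sum_erase_lt hn1 _ ?_
    rw [Finset.sum_add_distrib, ← hSθ]
    linarith only [hsumJ l hl, hsumJ l' hl', hρS₀]
  · -- `hslt`
    intro i l hl
    linarith only [hterm l hl i, hρS₀']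
  · -- `hsθ`: rows with non-zero aggregate are below the threshold `(1+ε)θ/2`
    intro i₀ l hl hR l' hl'
    have hl'1 : ∑ j ∈ univ.erase i₀, ρ * δ * ((l' j : ℝ) + 1) < (1 - ε) * θ / 2 :=
      (Finset.mem_filter.1 hl').2
    by_cases hle : ∑ j ∈ univ.erase i₀, ρ * δ * ((l j : ℝ) + 1) ≤ (1 + ε) * θ / 2
    · rw [Finset.sum_add_distrib]; linarith only [hle, hl'1]
    · exfalso
      refine hR ?_
      push Not at hle
      rw [rowSum_goodIndex_eq hδpos hFs hcJ i₀ hl]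
      suffices hz : ∑ m ∈ Finset.Icc (-(L : ℤ)) L, cellAvg δ F (Function.update l i₀ m) = 0 by
        rw [hz, mul_zero]
      by_cases hA : ∃ j, j ≠ i₀ ∧ l j ≤ 0
      · -- the whole row misses the support of `F`
        obtain ⟨j, hj, hlj⟩ := hA
        refine Finset.sum_eq_zero fun m' _ => cellAvg_eq_zero_of_forall fun y hy => ?_
        by_contra hFy
        have hys := hFs hFy
        rw [mem_avgCell_iff] at hy
        have h1 := (hy j).2
        rw [Function.update_of_ne hj] at h1
        have h2 : (l j : ℝ) ≤ 0 := by exact_mod_cast hlj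
        have h3 := hys.1 j
        have h4 : δ * (l j : ℝ) ≤ 0 := by nlinarith only [hδpos, h2]
        linarith only [h1, h3, h4]
      · push Not at hA
        have hT : S < δ * L := by
          have h1 : δ * (1 / (ρ * δ) + 1) ≤ δ * L := mul_le_mul_of_nonneg_left hL' hδpos.le
          have h2 : δ * (1 / (ρ * δ) + 1) = 1 / ρ + δ := by field_simp
          linarith only [h1, h2, hSρ, hδpos]
        refine sum_cellAvg_row_eq_zero hδpos L i₀ hFm hC (by linarith only [hS1]) hT
          (fun y hy => ?_) l ?_
        · have hys := hFs hy
          exact ⟨hys.1 i₀, (Finset.single_le_sum (fun j _ => hys.1 j) (Finset.mem_univ i₀)).trans hys.2⟩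
        · -- the reduced cell lies in the vanishing-marginal region
          have hsum' : Λ' < ∑ j ∈ univ.erase i₀, δ * ((l j : ℝ) + 1) := by
            have hfac : ∑ j ∈ univ.erase i₀, ρ * δ * ((l j : ℝ) + 1) =
                ρ * ∑ j ∈ univ.erase i₀, δ * ((l j : ℝ) + 1) := by
              rw [Finset.mul_sum]; refine Finset.sum_congr rfl fun j _ => by ring
            rw [hfac] at hle
            rw [hΛ'def, div_lt_iff₀ (by positivity)]
            linarith only [hle]
          filter_upwards [hmarg i₀] with t ht htQ
          rw [mem_rowCell_iff] at htQ
          have hpos : ∀ j, 0 ≤ t j := fun j => by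
            have h1 := (htQ j).1
            have h2 : (1 : ℝ) ≤ (l (i₀.succAbove j) : ℝ) := by
              exact_mod_cast hA _ (Fin.succAbove_ne i₀ j)
            have h3 : 0 ≤ δ * ((l (i₀.succAbove j) : ℝ) - 1) :=
              mul_nonneg hδpos.le (by linarith only [h2])
            linarith only [h1, h3]
          refine ht hpos ?_
          have hse : ∑ j, δ * ((l (i₀.succAbove j) : ℝ) - 1) =
              ∑ i ∈ univ.erase i₀, δ * ((l i : ℝ) + 1) - 2 * n * δ := by
            have h1 := Fin.sum_univ_succAbove (fun i => δ * ((l i : ℝ) + 1)) i₀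
            rw [Finset.sum_erase_eq_sub (Finset.mem_univ i₀), h1]
            have h2 : ∑ j : Fin n, δ * ((l (i₀.succAbove j) : ℝ) - 1) =
                ∑ j : Fin n, δ * ((l (i₀.succAbove j) : ℝ) + 1) - 2 * n * δ := by
              rw [eq_sub_iff_add_eq, show (2 : ℝ) * n * δ = ∑ _j : Fin n, 2 * δ by
                rw [Finset.sum_const, Finset.card_univ, Fintype.card_fin, nsmul_eq_mul]; ring,
                ← Finset.sum_add_distrib]
              refine Finset.sum_congr rfl fun j _ => by ring
            rw [h2]
            ring
          calc 1 + ε ≤ Λ' - 2 * n * δ := by linarith only [hnδ']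
            _ < ∑ j, δ * ((l (i₀.succAbove j) : ℝ) - 1) := by rw [hse]; linarith only [hsum']
            _ ≤ ∑ j, t j := Finset.sum_le_sum fun j _ => (htQ j).1

end Assembly

/-! ### `DHL[3,2]` from `EH` and the `GEH` non-prime asymptotic, via Theorem 3.15 -/

section Three

/-- **Theorem 3.2(xii) reduced to Theorem 3.6(ii).**  If the primes have every level of distribution
`θ < 1` (`EH[θ]`, available from `GEH` by Proposition 2.7) and the `GEH` non-prime asymptotic
Theorem 3.6(ii) holds at every level `0 < ϑ < 1`, then `DHL[3,2]`: Theorem 3.14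
(`weakDHL_of_vanishingMarginals`, `k = 3`, `m = 1`, `ε = 1/4`) applied to the cutoff of Theorem 3.15
(`GEHCutoff.exists_vanishingMarginalCutoff_three`) at `ϑ = (1 + 2I(F)/Σᵢ Jᵢ(F))/2 < 1`, with
Theorem 3.5(i) from the tree (`theta_divisorSumWeights_asymptotic_holds`); p. 11: "Theorem 3.2(xii)
is then an immediate consequence of Theorem 3.14 and [Theorem 3.15]". [cite: Polymath8b2014, Theorem 3.2(xii) (deduction from Theorems 3.14 and 3.15, p. 11)] -/
theorem weakDHL_three_two_of_primesLevel_of_nonprimeAsymptotic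
    (hPL : ∀ θ : ℝ, 0 < θ → θ < 1 → PrimesHaveLevel θ)
    (h36 : ∀ θ : ℝ, 0 < θ → θ < 1 → ∀ (H : Finset ℤ), IsAdmissibleTuple H → 1 ≤ #H →
      ∀ (b : ℝ → ℤ), (∀ x, ∀ h ∈ H, Int.gcd (b x + h) (polymathW x) = 1) →
      ∀ h₀ ∈ H, ∀ (F G : ℤ → ℝ → ℝ) (sF sG : ℤ → ℝ),
        (∀ h ∈ H, IsSieveCutoff (F h) (sF h)) → (∀ h ∈ H, IsSieveCutoff (G h) (sG h)) →
        ∑ h ∈ H.erase h₀, (sF h + sG h) < θ →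
        (fun x : ℝ => ∑ n ∈ polymathRange x (b x),
              ∏ h ∈ H, (divisorSumWeight (F h) x ((n : ℤ) + h).toNat *
                divisorSumWeight (G h) x ((n : ℤ) + h).toNat)
            - (∏ h ∈ H, ∫ t in (0 : ℝ)..1, deriv (F h) t * deriv (G h) t) *
              (x / (polymathB x ^ #H * polymathW x)))
          =o[atTop] fun x : ℝ => x / (polymathB x ^ #H * polymathW x)) :
    WeakDicksonHardyLittlewood 3 2 := by
  obtain ⟨F, hFm, ⟨C, hC⟩, hFs, -, hmarg, hIpos, hratio⟩ :=
    GEHCutoff.exists_vanishingMarginalCutoff_three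
  -- the ratio `ρ = 2 I / Σ J < 1`, and `ϑ := (1 + ρ)/2`
  set S : ℝ := ∑ i : Fin 3, polymathJ 3 (1 - 1 / 4) i F with hS
  have hSpos : 0 < S := lt_trans (by positivity) hratio
  set ρ : ℝ := 2 * polymathI 3 F / S with hρ
  have hρ1 : ρ < 1 := by rw [hρ, div_lt_one hSpos]; exact hratio
  have hρ0 : 0 < ρ := by rw [hρ]; positivity
  set ϑ : ℝ := (1 + ρ) / 2 with hϑ
  have hϑ0 : 0 < ϑ := by rw [hϑ]; linarith
  have hϑ1 : ϑ < 1 := by rw [hϑ]; linarith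
  have key : 2 * ((1 : ℕ) : ℝ) / ϑ * polymathI 3 F < S := by
    rw [Nat.cast_one, mul_one]
    have h1 : 2 * polymathI 3 F = ρ * S := by rw [hρ]; field_simp
    rw [div_mul_eq_mul_div, h1, div_lt_iff₀ hϑ0]
    have hϑρ : ρ < ϑ := by rw [hϑ]; linarith
    nlinarith
  have e : (((2 : ℕ) : ℝ) + 1) / ((2 : ℕ) : ℝ) = 3 / 2 := by norm_num
  exact weakDHL_of_vanishingMarginals (n := 2) (m := 1) theta_divisorSumWeights_asymptotic_holds
    (h36 ϑ hϑ0 hϑ1) le_rfl le_rfl hϑ0 hϑ1 (hPL ϑ hϑ0 hϑ1) (ε := 1 / 4) (by norm_num) (by norm_num)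
    hFm hC (by rw [e]; exact hFs) hmarg hIpos key

end Three

end Literature.NumberTheory.Sieve
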